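import Summits.FinalStateConjecture.FinalStateConjecture.Statement
import Literature.Geometry.Lorentzian.CausalCurveNullGeodesic

/-!
# Solo (blind) — two causal bookkeeping lemmas behind the focal-data analysis

Two elementary facts used in the analysis of the typed final state conjecture
(`paper/focal-exceptional.md`, Theorem B, Steps 2 and 4):

* `soloBlind_not_mem_causalPast_of_mem_chronologicalFuture` — for an ACHRONAL set `S`, no point
  lies both in `I⁺(S)` and in `J⁻(S)`: `s₁ ≪ y ≤ s₂` would give `s₁ ≪ s₂` by push-up (O'Neill 1983,
  Ch. 14, Cor. 14.1, p. 402, and p. 413). This is the contradiction step when a late certified leaf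
  `L` (an achronal slab) has a focal event in its chronological future that the exhaustion clause
  places in its causal past; `soloBlind_disjoint_chronologicalFuture_causalPast` is the set form.
* `soloBlind_bddAbove_of_not_mem_closure` — the contrapositive reading of the clause
  `RaysStayInClosure 𝒟 O` of the statement: a normalised null ray from the data which, at some
  parameter `t ≥ 0` of its domain, lies outside `closure O` has affine domain bounded above, i.e. is
  future-incomplete. With `O = exteriorOf 𝒟 d.charted` this is the interior-incompleteness
  commitment of the typed conjecture (every complete ray is confined to the closed exterior).

References: B. O'Neill, *Semi-Riemannian geometry*, Academic Press 1983, Ch. 14, pp. 402, 413;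
D. Christodoulou, CQG 16 (1999) A23, pp. A26–A27 (normalised null rays).
-/

noncomputable section

open Literature.Geometry.Lorentzian Set
open scoped Manifold ContDiff Topology

set_option linter.dupNamespace false

namespace Summit.FinalStateConjecture.FinalStateConjecture.Theorems

section Achronal

variable {E : Type*} [NormedAddCommGroup E] [NormedSpace ℝ E] {H : Type*} [TopologicalSpace H]
  {I : ModelWithCorners ℝ E H} {M : Type*} [TopologicalSpace M] [ChartedSpace H M]
  [IsManifold I ∞ M] [FiniteDimensional ℝ E] [BoundarylessManifold I M] {n : ℕ∞ω}
  {g : LorentzianMetric I n M} {τ : TimeOrientation g}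

/-- For an achronal set `S` (of a `Cⁿ` time-oriented Lorentzian manifold without boundary,
`1 ≤ n`), a point of `I⁺(S)` is not in `J⁻(S)`: if `s₁ ≪ y` and `y ≤ s₂` with `s₁, s₂ ∈ S` then
`s₁ ≪ s₂` by push-up, contradicting achronality. O'Neill 1983, Ch. 14, Cor. 14.1 (p. 402) with
p. 413. -/
theorem soloBlind_not_mem_causalPast_of_mem_chronologicalFuture (hn : 1 ≤ n) {S : Set M}
    (hA : g.IsAchronal τ S) {y : M} (hy : y ∈ g.chronologicalFuture τ S) :
    y ∉ g.causalPast τ S := by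
  intro hy'
  rw [LorentzianMetric.chronologicalFuture_eq_biUnion] at hy
  simp only [mem_iUnion, exists_prop] at hy
  obtain ⟨s₁, hs₁, hys₁⟩ := hy
  rw [LorentzianMetric.causalPast, LorentzianMetric.causalFuture_eq_biUnion] at hy'
  simp only [mem_iUnion, exists_prop] at hy'
  obtain ⟨s₂, hs₂, hys₂⟩ := hy'
  have h₂ : s₂ ∈ g.causalFuture τ {y} := by
    rw [← LorentzianMetric.causalPast_reverse]
    exact LorentzianMetric.mem_causalFuture_reverse_of_mem_causalFuture hys₂
  exact hA s₁ hs₁ s₂ hs₂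
    (mem_chronologicalFuture_of_mem_causalFuture_of_mem_chronologicalFuture τ hn hys₁ h₂)

/-- Set form: for an achronal `S`, `I⁺(S)` and `J⁻(S)` are disjoint (`1 ≤ n`, no boundary).
O'Neill 1983, Ch. 14, pp. 402, 413. -/
theorem soloBlind_disjoint_chronologicalFuture_causalPast (hn : 1 ≤ n) {S : Set M}
    (hA : g.IsAchronal τ S) :
    Disjoint (g.chronologicalFuture τ S) (g.causalPast τ S) :=
  Set.disjoint_left.2 fun _ hy ↦ soloBlind_not_mem_causalPast_of_mem_chronologicalFuture hn hA hy

end Achronal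

section Rays

variable {X : Type} [TopologicalSpace X] [ChartedSpace E3 X] [IsManifold (𝓡 3) ∞ X]
  [ConnectedSpace X] {D : InitialDataSet (𝓡 3) X}

/-- Contrapositive reading of `RaysStayInClosure`: a normalised null ray from the data hypersurface
that lies outside `closure O` at some parameter `t ≥ 0` of its domain has affine domain bounded
above (is future-incomplete). Christodoulou, CQG 16 (1999) A23, pp. A26–A27 (normalised rays). -/
theorem soloBlind_bddAbove_of_not_mem_closure (𝒟 : CauchyDevelopment D) {O : Set 𝒟.carrier}
    (h : RaysStayInClosure 𝒟 O) [𝒟.metric.HasLeviCivita] {p : X} {γ : ℝ → 𝒟.carrier}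
    {dom : Set ℝ}
    (hγ : 𝒟.metric.IsNormalisedNullRayFrom 𝒟.timeOrientation 𝒟.embed 𝒟.normal p γ dom)
    {t : ℝ} (ht : t ∈ dom) (h0 : 0 ≤ t) (hout : γ t ∉ closure O) : BddAbove dom := by
  by_contra hb
  exact hout (h p γ dom hγ hb t ht h0)

/-- Equivalently: under `RaysStayInClosure 𝒟 O`, along a future-complete (domain unbounded above)
normalised null ray from the data, the set of parameters `t ≥ 0` of the domain at which the ray is
outside `closure O` is empty. Christodoulou, CQG 16 (1999) A23, pp. A26–A27. -/
theorem soloBlind_exitSet_eq_empty (𝒟 : CauchyDevelopment D) {O : Set 𝒟.carrier}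
    (h : RaysStayInClosure 𝒟 O) [𝒟.metric.HasLeviCivita] {p : X} {γ : ℝ → 𝒟.carrier}
    {dom : Set ℝ}
    (hγ : 𝒟.metric.IsNormalisedNullRayFrom 𝒟.timeOrientation 𝒟.embed 𝒟.normal p γ dom)
    (hdom : ¬ BddAbove dom) : {t ∈ dom | 0 ≤ t ∧ γ t ∉ closure O} = ∅ := by
  ext t
  simp only [mem_setOf_eq, mem_empty_iff_false, iff_false, not_and, not_not]
  exact fun ht h0 ↦ h p γ dom hγ hdom t ht h0

end Rays

end Summit.FinalStateConjecture.FinalStateConjecture.Theorems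

end
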